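import Literature.Computability.FineGrained.SubcubicEquivalencesAPSP
import HarnessLib

/-!
# Subcubic equivalence of APSP and Negative Triangle: the two directions for `TrulySubTime`

Vassilevska Williams–Williams, *Subcubic equivalences between path, matrix, and triangle
problems*, J. ACM 65 (2018), Art. 27, Thm. 1.1 (p. 27:3, restated p. 27:22): APSP, Negative
Triangle, the `(min,+)`-product, … "either all have truly subcubic algorithms, or none of them do".

The decomposition of the tree's unconditional target
`Literature.Computability.FineGrained.trulySubTime_APSP_iff_negativeTriangle` along the printed proof — the two halves
`APSP_fgReducible_negativeTriangle` / `negativeTriangle_fgReducible_APSP` of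
`subcubicEquivalent_APSP_negativeTriangle`, the route through the distance product, and the proved
well-formedness theorems `APSP_isStandard`, `NegativeTriangle_isStandard`,
`MinPlusProduct_isStandard` — lives in
`Literature.Computability.FineGrained.SubcubicEquivalencesAPSP`, which landed concurrently with the
first version of this module; the duplicated material (the same two halves under the names
`…_subcubicReducible_…`, a second proof of the three `IsStandard` theorems, and a second
`subcubicEquivalent_APSP_negativeTriangle_iff`, which made the two modules unimportable together)
has been removed from here in favour of that module.

What this module adds are the consequences for `FGProblem.TrulySubTime`, direction by direction:

* `trulySubTime_negativeTriangle_of_APSP`: the direction of Thm. 1.1 that only needs Thm. 4.1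
  (p. 27:14) and the tripartite embedding of the distance product into APSP (proof of Thm. 5.1,
  p. 27:22), i.e. the half `negativeTriangle_fgReducible_APSP`, together with the corrected transfer
  property `trulySubTime_of_fgReducible_of_sizeFitsWord` (VVW ICM 2018, remark after Def. 2.1;
  named fact of `FGComplexity`);
* `trulySubTime_APSP_of_negativeTriangle`: the direction that needs Thm. 4.2 (p. 27:14, proof
  pp. 27:17–18), i.e. the half `APSP_fgReducible_negativeTriangle`;
* `trulySubTime_APSP_iff_negativeTriangle_of`: both together give the target; and the conditional
  named fact `trulySubTime_APSP_iff_negativeTriangle_of_isStandard` of `Conjectures` is *equivalent*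
  to the unconditional one now that its well-formedness hypotheses are theorems
  (`trulySubTime_APSP_iff_negativeTriangle_of_isStandard_iff`).

What remains for the unconditional theorem are verified word-RAM programs: the two oracle
reductions and the inline-simulation theorem behind the transfer property.

## References

* V. Vassilevska Williams, R. R. Williams, *Subcubic equivalences between path, matrix, and
  triangle problems*, J. ACM 65 (2018), Art. 27. doi:10.1145/3186893 — Thm. 1.1 (p. 27:3, p. 27:22),
  Def. 3.1 and Prop. 2 (pp. 27:10–11), Thm. 4.1 and Thm. 4.2 (p. 27:14), proof of Thm. 4.2
  (pp. 27:17–18), proof of Thm. 5.1 (p. 27:22).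
* V. Vassilevska Williams, *On some fine-grained questions in algorithms and complexity*,
  Proc. ICM 2018, §2 (word RAM, Def. 2.1 and the transfer remark).
-/

namespace Literature.Computability.FineGrained

open Cryptography

/-- With the well-formedness facts proved (`APSP_isStandard`, `NegativeTriangle_isStandard`), the
conditional named fact `trulySubTime_APSP_iff_negativeTriangle_of_isStandard` of `Conjectures` is
equivalent to the unconditional `trulySubTime_APSP_iff_negativeTriangle`. [folklore] -/
theorem trulySubTime_APSP_iff_negativeTriangle_of_isStandard_iff :
    trulySubTime_APSP_iff_negativeTriangle_of_isStandard ↔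
      trulySubTime_APSP_iff_negativeTriangle :=
  ⟨fun h => h APSP_isStandard NegativeTriangle_isStandard, fun h _ _ => h⟩

/-- **VW–W Thm. 1.1 for APSP and Negative Triangle, from its printed ingredients**: the corrected
transfer property of fine-grained reductions (VVW ICM 2018, remark after Def. 2.1;
`trulySubTime_of_fgReducible_of_sizeFitsWord`) and the two subcubic reductions give
`trulySubTime_APSP_iff_negativeTriangle` — the well-formedness (`APSP_isStandard`,
`NegativeTriangle_isStandard`) and word-size (`APSP_sizeFitsWord`, `NegativeTriangle_sizeFitsWord`)
side conditions of the word-RAM model are theorems. (The same statement with the two halves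
bundled as `subcubicEquivalent_APSP_negativeTriangle` is
`trulySubTime_APSP_iff_negativeTriangle_of_facts`.)
[cite: VassilevskaWilliamsWilliams2018, Thm. 1.1 (p. 27:3; p. 27:22)] -/
theorem trulySubTime_APSP_iff_negativeTriangle_of
    (hF : trulySubTime_of_fgReducible_of_sizeFitsWord)
    (h₁ : APSP_fgReducible_negativeTriangle)
    (h₂ : negativeTriangle_fgReducible_APSP) : trulySubTime_APSP_iff_negativeTriangle :=
  trulySubTime_APSP_iff_negativeTriangle_of_facts hF
    (subcubicEquivalent_APSP_negativeTriangle_of_reductions h₁ h₂)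

/-- The direction of Thm. 1.1 that only needs Thm. 4.1 (and the tripartite embedding of the distance
product into APSP, proof of Thm. 5.1): if APSP with weights in `[-n^c, n^c]` is truly subcubic for
every `c`, then so is Negative Triangle (from the corrected transfer property and
`negativeTriangle_fgReducible_APSP`). [cite: VassilevskaWilliamsWilliams2018, Thm. 4.1 (p. 27:14) and proof of Thm. 5.1 (p. 27:22)] -/
theorem trulySubTime_negativeTriangle_of_APSP
    (hF : trulySubTime_of_fgReducible_of_sizeFitsWord)
    (h₂ : negativeTriangle_fgReducible_APSP) (h : ∀ c, (APSP c).TrulySubTime 3) (c : ℕ) :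
    (NegativeTriangle c).TrulySubTime 3 := by
  obtain ⟨c', hc'⟩ := h₂ c
  exact hF hc' (h c') (NegativeTriangle_isStandard c) (APSP_isStandard c')
    (NegativeTriangle_sizeFitsWord c)

/-- The direction of Thm. 1.1 that needs Thm. 4.2: if Negative Triangle with weights in
`[-n^c, n^c]` is truly subcubic for every `c`, then so is APSP (from the corrected transfer property
and `APSP_fgReducible_negativeTriangle`). [cite: VassilevskaWilliamsWilliams2018, Thm. 4.2 (p. 27:14)] -/
theorem trulySubTime_APSP_of_negativeTriangle
    (hF : trulySubTime_of_fgReducible_of_sizeFitsWord)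
    (h₁ : APSP_fgReducible_negativeTriangle) (h : ∀ c, (NegativeTriangle c).TrulySubTime 3)
    (c : ℕ) : (APSP c).TrulySubTime 3 := by
  obtain ⟨c', hc'⟩ := h₁ c
  exact hF hc' (h c') (APSP_isStandard c) (NegativeTriangle_isStandard c') (APSP_sizeFitsWord c)

/-- The two directions reassemble the equivalence. [cite: VassilevskaWilliamsWilliams2018, Thm. 1.1] -/
theorem trulySubTime_APSP_iff_negativeTriangle_of'
    (hF : trulySubTime_of_fgReducible_of_sizeFitsWord)
    (h₁ : APSP_fgReducible_negativeTriangle)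
    (h₂ : negativeTriangle_fgReducible_APSP) : trulySubTime_APSP_iff_negativeTriangle :=
  ⟨fun h c => trulySubTime_negativeTriangle_of_APSP hF h₂ h c,
    fun h c => trulySubTime_APSP_of_negativeTriangle hF h₁ h c⟩

end Literature.Computability.FineGrained
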